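import Summits.BirchSwinnertonDyer.Rank2.Chi8FloorCertificate
import HarnessLib

/-!
# The χ₈-floor kernel, Part B of 8 — §ConductorLevel, §EighthAnyLevel

Planner p2 GEN 40–42 kernel `Chi8Floor` v10 (cell bsd-rank2, HOME/p2/g43/lean/Chi8Floor_v10.lean, sha bc257584; 60 theorems, `lean check` rc 0 / 0 sorry),
split into ≤400-line tree files `Rank2/Chi8Floor{Certificate,ConductorLevel,TwistDoor,LatticeEngine,TwistDoorProved,PeriodFree,TwistDoorFinal,KatoFree}`
(A–H, a linear import chain) by the lead star-p1 GEN 18 at the planner's LANDING ASK.  The mathematical overview, the honest framing (Barrier B1: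
`ord_{T=0} L₂` is the 2-adic analytic order, never `r_an`; BSD is not proved) and the references are in Part A's module docstring
(`Rank2/Chi8FloorCertificate.lean`); every theorem below carries its own `[cite: …]` tags.  Theorems only; no definition, no named fact, no instance.
[cite: MazurTateTeitelbaum1986Invent, §I.14 Proposition (p. 20)] [cite: Kato2004Asterisque, Thm. 18.4 (p. 281)] [cite: GreenbergLNM1716, §5 (p. 181)]
[cite: Stevens1989, Lemma (5.4)]
-/

noncomputable section

open PowerSeries WeierstrassCurve CongruenceSubgroup Filter
open Literature.NumberTheory.EllipticCurves Literature.NumberTheory.EllipticCurves.ModularForms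
open Literature.Barriers.BirchSwinnertonDyer

namespace Summit.BirchSwinnertonDyer.Rank2

section ConductorLevel

variable {W : WeierstrassCurve ℚ} [W.IsElliptic] [W.IsGloballyMinimal] [NeZero (W.conductorNorm ℤ)]
  {f : CuspForm (Gamma0 (W.conductorNorm ℤ)) 2}

/-- **χ₈-floor certificate, even sign (conductor level).** `E/ℚ` globally minimal, good ordinary at
`2`, newform `f` at the conductor level, root number `+1`, `L(E,1) = 0`; if `‖c_k‖₂ ≤ 2^{-m}` for all
`k` and `‖S₈(f)‖₂ > 2^{-(m+4)}`, then `ord_{T=0} L₂(E,T) = 2`: the order is finite (Rohrlich), even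
(`w_E = (−1)^{ord}`), `≥ 1` (`L(E,1) = 0`) and `≤ 3` (the floor).
[cite: MazurTateTeitelbaum1986Invent, §I.14 Proposition (p. 20)] [cite: GreenbergLNM1716, §5 (p. 181)] -/
theorem order_padicLFunction_eq_two_of_chi8Floor
    (hord : IsOrdinaryAt W 2) (hf : IsNewformOf W f)
    (hw : W.rootNumber = 1) (hL : W.entireLFunction 1 = 0) (m : ℕ)
    (hdiv : ∀ k : ℕ, ‖padicLCoeff f (unitRoot W 2 : ℚ_[2]) k‖ ≤ (2 : ℝ)⁻¹ ^ m)
    (hS : (2 : ℝ)⁻¹ ^ (m + 4) <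
      ‖((ratTwistedSymbolSum f (ZMod.χ₈.ringHomComp (Int.castRingHom ℚ)) : ℚ) : ℚ_[2])‖) :
    (padicLFunction f (unitRoot W 2 : ℚ_[2])).order = 2 := by
  set L := padicLFunction f (unitRoot W 2 : ℚ_[2]) with hLdef
  have hL0 : L ≠ 0 := padicLFunction_unitRoot_ne_zero hord hf
  have hn : (L.order.toNat : ℕ∞) = L.order := coe_toNat_order hL0
  set n := L.order.toNat with hndef
  -- parity: `w_E = (-1)^n = 1`, so `n` is even
  have hsign := rootNumber_eq_neg_one_pow_order_padicLFunction_conductorLevel_anyPrime hord hf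
  rw [hw, ← hLdef, ← hndef] at hsign
  push_cast at hsign
  have heven : Even n := (neg_one_pow_eq_one_iff_even (by norm_num)).mp hsign.symm
  -- `L(E,1) = 0` gives `1 ≤ ord`; the floor gives `ord ≤ 3`
  have h1 : 1 ≤ L.order := (one_le_order_padicLFunction_iff W 2 hord hf).mpr hL
  have h3 : L.order ≤ 3 := order_padicLFunction_le_three_of_chi8Floor hord hf m hdiv hS
  rw [← hn] at h1 h3
  have h1n : 1 ≤ n := by exact_mod_cast h1
  have h3n : n ≤ 3 := by exact_mod_cast h3
  obtain ⟨k, hk⟩ := heven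
  have : n = 2 := by omega
  rw [← hn, this]; rfl

/-- **χ₈-floor certificate, unconditional form (`m = 0`, from INT2-AUTO).** For `E/ℚ` good ordinary
at `2` with `w_E = +1` and `L(E,1) = 0`: `v₂(S₈(f)) ≤ 3`, i.e. `‖S₈(f)‖₂ > 1/16`, implies
`ord_{T=0} L₂(E,T) = 2`. [cite: MazurTateTeitelbaum1986Invent, §I.14 Proposition (p. 20)] -/
theorem order_padicLFunction_eq_two_of_chi8Floor₀
    (hord : IsOrdinaryAt W 2) (hf : IsNewformOf W f)
    (hw : W.rootNumber = 1) (hL : W.entireLFunction 1 = 0)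
    (hS : (2 : ℝ)⁻¹ ^ 4 <
      ‖((ratTwistedSymbolSum f (ZMod.χ₈.ringHomComp (Int.castRingHom ℚ)) : ℚ) : ℚ_[2])‖) :
    (padicLFunction f (unitRoot W 2 : ℚ_[2])).order = 2 :=
  order_padicLFunction_eq_two_of_chi8Floor hord hf hw hL 0
    (fun k ↦ by simpa using padicLFunction_integral_two_auto hord hf k) (by simpa using hS)

/-- **The rank-2 equality door at `p = 2` (even sign).** Granting Kato's bound at `2` in the tree's
all-primes form (`kato_selmerCorank_le_order_padicLFunction_allPrimes W 2`; Kato Thm 17.4/18.4,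
printed at `p = 2` "exact up to `×2`"), an `E` with a planted `rank E(ℚ) ≥ 2`, `w_E = +1`, good
ordinary `2` and the χ₈-floor inequality has
`rank E(ℚ) = corank_{ℤ₂} Sel_{2^∞}(E/ℚ) = ord_{T=0} L₂(E,T) = 2` and `corank Ш(E)[2^∞] = 0`;
`L(E,1) = 0` is derived inside (`1 ≤ 2 ≤ rank ≤ corank ≤ ord` and `one_le_order_padicLFunction_iff`).
No main conjecture, no `p`-adic height, no `λ`/`μ` law.
[cite: Kato2004Asterisque, Thm. 18.4 (p. 281)] [cite: MazurTateTeitelbaum1986Invent, §I.14 Proposition (p. 20)] -/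
theorem rank_eq_selmerCorank_eq_order_eq_two_of_chi8Floor
    (hord : IsOrdinaryAt W 2) (hf : IsNewformOf W f)
    (hw : W.rootNumber = 1) (m : ℕ)
    (hdiv : ∀ k : ℕ, ‖padicLCoeff f (unitRoot W 2 : ℚ_[2]) k‖ ≤ (2 : ℝ)⁻¹ ^ m)
    (hS : (2 : ℝ)⁻¹ ^ (m + 4) <
      ‖((ratTwistedSymbolSum f (ZMod.χ₈.ringHomComp (Int.castRingHom ℚ)) : ℚ) : ℚ_[2])‖)
    (hKato : kato_selmerCorank_le_order_padicLFunction_allPrimes W 2 (f := f))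
    (hrank : 2 ≤ W.mordellWeilRank) :
    W.mordellWeilRank = 2 ∧ W.selmerCorank 2 = 2 ∧ W.shaCorank 2 = 0 ∧
      (padicLFunction f (unitRoot W 2 : ℚ_[2])).order = 2 := by
  have hkum := W.selmerCorank_eq_mordellWeilRank_add_holds 2
  have hKato' := hKato hord hf
  have hc1 : (1 : ℕ∞) ≤ W.selmerCorank 2 := by
    have : 1 ≤ W.selmerCorank 2 := by omega
    exact_mod_cast this
  have hL : W.entireLFunction 1 = 0 :=
    (one_le_order_padicLFunction_iff W 2 hord hf).mp (hc1.trans hKato')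
  have hord2 := order_padicLFunction_eq_two_of_chi8Floor hord hf hw hL m hdiv hS
  have hsel : (W.selmerCorank 2 : ℕ∞) ≤ 2 := hord2 ▸ hKato'
  have hsel' : W.selmerCorank 2 ≤ 2 := by exact_mod_cast hsel
  exact ⟨by omega, by omega, by omega, hord2⟩

/-- The rank-2 door with `m = 0` supplied by INT2-AUTO: hypotheses = {good ordinary `2`, newform at
the conductor level, `w_E = +1`, `v₂(S₈(f)) ≤ 3`, Kato's bound at `2`, planted rank `≥ 2`}.
[cite: Kato2004Asterisque, Thm. 18.4 (p. 281)] [cite: MazurTateTeitelbaum1986Invent, §I.14 Proposition (p. 20)] -/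
theorem rank_eq_selmerCorank_eq_order_eq_two_of_chi8Floor₀
    (hord : IsOrdinaryAt W 2) (hf : IsNewformOf W f) (hw : W.rootNumber = 1)
    (hS : (2 : ℝ)⁻¹ ^ 4 <
      ‖((ratTwistedSymbolSum f (ZMod.χ₈.ringHomComp (Int.castRingHom ℚ)) : ℚ) : ℚ_[2])‖)
    (hKato : kato_selmerCorank_le_order_padicLFunction_allPrimes W 2 (f := f))
    (hrank : 2 ≤ W.mordellWeilRank) :
    W.mordellWeilRank = 2 ∧ W.selmerCorank 2 = 2 ∧ W.shaCorank 2 = 0 ∧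
      (padicLFunction f (unitRoot W 2 : ℚ_[2])).order = 2 :=
  rank_eq_selmerCorank_eq_order_eq_two_of_chi8Floor hord hf hw 0
    (fun k ↦ by simpa using padicLFunction_integral_two_auto hord hf k) (by simpa using hS)
    hKato hrank

/-- **Eighth-symbol certificate (conductor level).** `E/ℚ` good ordinary at `2`, `w_E = +1`,
`L(E,1) = 0`, `‖c_k‖₂ ≤ 2^{-m}` and `v₂([1/8]⁺_f) ≤ m + 1` ⇒ `ord_{T=0} L₂(E,T) = 2`.
[cite: MazurTateTeitelbaum1986Invent, §I.4 (4.2) and §I.14 Proposition (p. 20)] -/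
theorem order_padicLFunction_eq_two_of_eighthSymbol
    (hord : IsOrdinaryAt W 2) (hf : IsNewformOf W f)
    (hw : W.rootNumber = 1) (hL : W.entireLFunction 1 = 0) (m : ℕ)
    (hdiv : ∀ k : ℕ, ‖padicLCoeff f (unitRoot W 2 : ℚ_[2]) k‖ ≤ (2 : ℝ)⁻¹ ^ m)
    (h8 : (2 : ℝ)⁻¹ ^ (m + 2) < ‖((ratPlusSymbol f (1 / 8) : ℚ) : ℚ_[2])‖) :
    (padicLFunction f (unitRoot W 2 : ℚ_[2])).order = 2 :=
  order_padicLFunction_eq_two_of_chi8Floor hord hf hw hL m hdiv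
    (by simpa [show m + 2 + 2 = m + 4 by ring] using chi8Floor_of_eighthSymbol hord hf hL (m + 2) h8)

/-- **Eighth-symbol certificate, unconditional form**: `E/ℚ` good ordinary at `2`, `w_E = +1`,
`L(E,1) = 0` and `‖[1/8]⁺_f‖₂ > 1/4` — i.e. the integer-or-half-integer `[1/8]⁺_f` has
`v₂([1/8]⁺_f) ≤ 1` — give `ord_{T=0} L₂(E,T) = 2`.
[cite: MazurTateTeitelbaum1986Invent, §I.4 (4.2) and §I.14 Proposition (p. 20)] -/
theorem order_padicLFunction_eq_two_of_eighthSymbol₀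
    (hord : IsOrdinaryAt W 2) (hf : IsNewformOf W f)
    (hw : W.rootNumber = 1) (hL : W.entireLFunction 1 = 0)
    (h8 : (2 : ℝ)⁻¹ ^ 2 < ‖((ratPlusSymbol f (1 / 8) : ℚ) : ℚ_[2])‖) :
    (padicLFunction f (unitRoot W 2 : ℚ_[2])).order = 2 :=
  order_padicLFunction_eq_two_of_chi8Floor₀ hord hf hw hL
    (by simpa using chi8Floor_of_eighthSymbol hord hf hL 2 h8)

/-- **The rank-2 equality door, eighth-symbol form**: Kato's bound at `2` + planted `rank E(ℚ) ≥ 2` +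
`w_E = +1` + good ordinary `2` + `‖[1/8]⁺_f‖₂ > 1/4` ⇒
`rank E(ℚ) = corank_{ℤ₂} Sel_{2^∞}(E/ℚ) = ord_{T=0} L₂(E,T) = 2`, `corank Ш(E)[2^∞] = 0`.
[cite: Kato2004Asterisque, Thm. 18.4 (p. 281)] [cite: MazurTateTeitelbaum1986Invent, §I.4 (4.2) and §I.14] -/
theorem rank_eq_selmerCorank_eq_order_eq_two_of_eighthSymbol₀
    (hord : IsOrdinaryAt W 2) (hf : IsNewformOf W f) (hw : W.rootNumber = 1)
    (h8 : (2 : ℝ)⁻¹ ^ 2 < ‖((ratPlusSymbol f (1 / 8) : ℚ) : ℚ_[2])‖)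
    (hKato : kato_selmerCorank_le_order_padicLFunction_allPrimes W 2 (f := f))
    (hrank : 2 ≤ W.mordellWeilRank) :
    W.mordellWeilRank = 2 ∧ W.selmerCorank 2 = 2 ∧ W.shaCorank 2 = 0 ∧
      (padicLFunction f (unitRoot W 2 : ℚ_[2])).order = 2 := by
  have hkum := W.selmerCorank_eq_mordellWeilRank_add_holds 2
  have hKato' := hKato hord hf
  have hc1 : (1 : ℕ∞) ≤ W.selmerCorank 2 := by
    have : 1 ≤ W.selmerCorank 2 := by omega
    exact_mod_cast this
  have hL : W.entireLFunction 1 = 0 :=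
    (one_le_order_padicLFunction_iff W 2 hord hf).mp (hc1.trans hKato')
  exact rank_eq_selmerCorank_eq_order_eq_two_of_chi8Floor₀ hord hf hw
    (by simpa using chi8Floor_of_eighthSymbol hord hf hL 2 h8) hKato hrank

end ConductorLevel

section EighthAnyLevel

variable {W : WeierstrassCurve ℚ} [W.IsElliptic] [W.IsGloballyMinimal]
  {N : ℕ} [NeZero N] {f : CuspForm (Gamma0 N) 2}

/-- **The rank-3 equality door, eighth-symbol form (any level, no sign hypothesis)**: Kato's bound
at `2` + planted `rank E(ℚ) ≥ 3` + good ordinary `2` + `‖[1/8]⁺_f‖₂ > 1/4` ⇒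
`rank = corank = ord_{T=0} L₂ = 3`, `corank Ш(E)[2^∞] = 0`.
[cite: Kato2004Asterisque, Thm. 18.4 (p. 281)] [cite: MazurTateTeitelbaum1986Invent, §I.4 (4.2) and §I.14] -/
theorem rank_eq_selmerCorank_eq_order_eq_three_of_eighthSymbol₀
    (hord : IsOrdinaryAt W 2) (hf : IsNewformOf W f)
    (h8 : (2 : ℝ)⁻¹ ^ 2 < ‖((ratPlusSymbol f (1 / 8) : ℚ) : ℚ_[2])‖)
    (hKato : kato_selmerCorank_le_order_padicLFunction_allPrimes W 2 (f := f))
    (hrank : 3 ≤ W.mordellWeilRank) :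
    W.mordellWeilRank = 3 ∧ W.selmerCorank 2 = 3 ∧ W.shaCorank 2 = 0 ∧
      (padicLFunction f (unitRoot W 2 : ℚ_[2])).order = 3 := by
  have hkum := W.selmerCorank_eq_mordellWeilRank_add_holds 2
  have hKato' := hKato hord hf
  have hc1 : (1 : ℕ∞) ≤ W.selmerCorank 2 := by
    have : 1 ≤ W.selmerCorank 2 := by omega
    exact_mod_cast this
  have hL : W.entireLFunction 1 = 0 :=
    (one_le_order_padicLFunction_iff W 2 hord hf).mp (hc1.trans hKato')
  exact rank_eq_selmerCorank_eq_order_eq_three_of_chi8Floor₀ hord hf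
    (by simpa using chi8Floor_of_eighthSymbol hord hf hL 2 h8) hKato hrank

/-- **The parity-free equality door, eighth-symbol form (any level, planted rank `j+1 ≥ 1`)**:
Kato's bound at `2` + planted `rank E(ℚ) ≥ j+1` + good ordinary `2` + `‖[1/8]⁺_f‖₂ > 2^{-j}`
(i.e. `v₂([1/8]⁺_f) ≤ j − 1 = rank − 2`) ⇒ `rank = corank = ord_{T=0} L₂ = j+1`,
`corank Ш(E)[2^∞] = 0`. At `j = 1`: rank `≥ 2` and `[1/8]⁺_f` ODD; at `j = 2`: rank `≥ 3` and
`4 ∤ [1/8]⁺_f`. [cite: Kato2004Asterisque, Thm. 18.4 (p. 281)] [cite: MazurTateTeitelbaum1986Invent, §I.4 (4.2) and §I.14] -/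
theorem rank_eq_selmerCorank_eq_order_of_eighthSymbol₀
    (hord : IsOrdinaryAt W 2) (hf : IsNewformOf W f) (j : ℕ)
    (h8 : (2 : ℝ)⁻¹ ^ j < ‖((ratPlusSymbol f (1 / 8) : ℚ) : ℚ_[2])‖)
    (hKato : kato_selmerCorank_le_order_padicLFunction_allPrimes W 2 (f := f))
    (hrank : j + 1 ≤ W.mordellWeilRank) :
    W.mordellWeilRank = j + 1 ∧ W.selmerCorank 2 = j + 1 ∧ W.shaCorank 2 = 0 ∧
      (padicLFunction f (unitRoot W 2 : ℚ_[2])).order = (j + 1 : ℕ) := by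
  have hkum := W.selmerCorank_eq_mordellWeilRank_add_holds 2
  have hKato' := hKato hord hf
  have hc1 : (1 : ℕ∞) ≤ W.selmerCorank 2 := by
    have : 1 ≤ W.selmerCorank 2 := by omega
    exact_mod_cast this
  have hL : W.entireLFunction 1 = 0 :=
    (one_le_order_padicLFunction_iff W 2 hord hf).mp (hc1.trans hKato')
  exact rank_eq_selmerCorank_eq_order_of_chi8Floor₀ hord hf (j + 1)
    (by simpa [show j + 1 + 1 = j + 2 by ring] using chi8Floor_of_eighthSymbol hord hf hL j h8)
    hKato hrank

end EighthAnyLevel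

end Summit.BirchSwinnertonDyer.Rank2

end
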